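import Summits.ResolutionOfSingularities.ResolutionOfSingularities.Theorems.PAlterationPicoverTowerTransport
import Summits.ResolutionOfSingularities.ResolutionOfSingularities.Theorems.PAlterationPicoverOfNormalizationIn

/-!
# Crux `Picover` (stmt-ResolutionOfSingularities-0554): resolutions lift to the normalization
# in the function field of a finite cover

Route `ResolutionOfSingularities/pAlteration`, crux
`Summit.ResolutionOfSingularities.ResolutionOfSingularities.Theses.PAlteration.Picover`, residue
programme of the line `degree-p-tower` (lead c1). Converse companion of the landed comparison
`OfNormalizationIn.stub_ofNormalizationIn` (`HasResolution W^{K(X)} → HasResolution X`).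

**Statement** (`hasResolution_normalizationIn_of_hasResolution`). Let `W` be an integral scheme
locally of finite type over a field `k`, `L ⊇ K(W)` a finite extension, and `g : X → W` a finite
dominant morphism from an integral scheme together with a SURJECTIVE ring map `ψ : K(X) → L`
over `K(W)` (so `K(X) ≅ L` over `K(W)`). If `X` has a resolution of singularities then so has the
normalization `W^L = normalizationIn W L` of `W` in `L`. In particular
(`hasResolution_iff_hasResolution_normalizationIn`) for `g : X → W` finite dominant,
`X` has a resolution iff `W^{K(X)}` has one.

**Proof.** Let `ρ' : X' → X` be a resolution. Then `X'` is regular and integral, `ρ := ρ' ≫ g`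
is proper dominant, `K(X') ≅ K(X) ≅ L` over `K(W)` (birational maps are isomorphisms on
function fields), and the fibre of `ρ` over the generic point of `W` is the generic point of `X'`
(`g` is integral, `ρ'` is an isomorphism over a dense open). With `[L : K(X')] = 1` the landed
base case `BaseCase.stub_baseCase` says `X'^L ≅ X'` has a resolution, and the landed transport
theorem `TowerTransport.hasResolution_normalizationIn_of_isProper` carries it down the proper
birational comparison `X'^L → W^L`.

Use (this seat): `PicoverLocalModel ⟹ residue on affine bases`
(`Theorems/PAlterationPicoverLocalModelIffAffineDegP.lean`): the local model `Spec R[T]/(T^p-a)`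
is a finite cover of `Spec R` with function field `K(Spec R)(a^{1/p})`.

Sources: folklore (Liu 2002, §4.1.2 and Prop. 4.1.27; universal property of normalization,
Stacks 035Q). Tools: the landed files `PAlterationPicoverBaseCase`, `…TowerTransport`,
`…FunctionFieldNormalizationIn`, `…OfNormalizationIn`; Mathlib
`Algebra.finrank_eq_one_iff_bijective_algebraMap`. No new definitions.
-/

noncomputable section

set_option linter.dupNamespace false -- mandated namespace of this single-conjunct summit

open CategoryTheory AlgebraicGeometry TopologicalSpace
open Literature.AlgebraicGeometry.Resolution Literature.AlgebraicGeometry.Motives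
open Summit.ResolutionOfSingularities.ResolutionOfSingularities.Theorems.Picover

namespace Summit.ResolutionOfSingularities.ResolutionOfSingularities.Theorems.Picover.LiftToNormalizationIn

/-- **Resolutions lift to the normalization in the function field of a finite cover.** For `W`
integral, locally of finite type over a field `k`, `L/K(W)` finite, `g : X → W` finite dominant
with `X` integral, and `ψ : K(X) → L` a surjective ring map over `K(W)`: a resolution of `X`
yields a resolution of `normalizationIn W L`. [folklore] -/
theorem hasResolution_normalizationIn_of_hasResolution {k : Type} [Field k] (W : Scheme.{0})
    [IsIntegral W] (f : W ⟶ Spec (.of k)) [LocallyOfFiniteType f] (L : Type) [Field L]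
    [Algebra W.functionField L] [FiniteDimensional W.functionField L] (X : Scheme.{0})
    [IsIntegral X] (g : X ⟶ W) [IsFinite g] [IsDominant g] (ψ : X.functionField →+* L)
    (hψ : ψ.comp (RatFn.functionFieldMap g) = algebraMap W.functionField L)
    (hψs : Function.Surjective ψ) (hres : Scheme.HasResolution X) :
    Scheme.HasResolution (normalizationIn W L) := by
  have hK0 := FunctionFieldNormalizationIn.stub_functionField_normalizationIn
  obtain ⟨X', ρ', hρ'⟩ := hres
  haveI : IsProper ρ' := hρ'.isProper
  haveI : IsReduced X' := hρ'.isRegular.isReduced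
  haveI : IsIntegral X' := hρ'.isBirational.isIntegral
  haveI : IsDominant ρ' := hρ'.isBirational.isDominant
  -- function fields: `K(X') ≅ K(X) ≅ L` over `K(W)`
  have hbij : Function.Bijective (RatFn.functionFieldMap ρ') :=
    TowerTransport.bijective_functionFieldMap_of_isIso ρ'
      hρ'.isBirational.isIso_stalkMap_genericPoint
  let eψ : X.functionField ≃+* L := RingEquiv.ofBijective ψ ⟨ψ.injective, hψs⟩
  let e' : X'.functionField ≃+* L := (RingEquiv.ofBijective _ hbij).symm.trans eψ
  have he' : e'.toRingHom.comp (RatFn.functionFieldMap ρ') = ψ := by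
    refine RingHom.ext fun x => ?_
    simp only [e', eψ, RingEquiv.toRingHom_eq_coe, RingHom.coe_comp, RingHom.coe_coe,
      Function.comp_apply, RingEquiv.coe_trans]
    have h2 : (RingEquiv.ofBijective (RatFn.functionFieldMap ρ') hbij).symm
        (RatFn.functionFieldMap ρ' x) = x :=
      (RingEquiv.ofBijective (RatFn.functionFieldMap ρ') hbij).symm_apply_apply x
    rw [h2]
    rfl
  letI : Algebra X'.functionField L := e'.toRingHom.toAlgebra
  have halg : algebraMap X'.functionField L = e'.toRingHom := rfl
  have hcompat : (algebraMap X'.functionField L).comp (RatFn.functionFieldMap (ρ' ≫ g)) =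
      algebraMap W.functionField L := by
    rw [RatFn.functionFieldMap_comp g ρ', halg, ← RingHom.comp_assoc, he', hψ]
  have hdeg : Module.finrank X'.functionField L = 1 :=
    Algebra.finrank_eq_one_iff_bijective_algebraMap.mpr (by rw [halg]; exact e'.bijective)
  haveI : FiniteDimensional X'.functionField L :=
    Module.finite_of_finrank_pos (by rw [hdeg]; exact one_pos)
  -- the base case: `X'^L ≅ X'` is regular
  have hres' : Scheme.HasResolution (normalizationIn X' L) :=
    BaseCase.stub_baseCase X' L (hK0 X' L) hρ'.isRegular hdeg
  -- the fibre of `ρ' ≫ g` over the generic point of `W` is the generic point of `X'`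
  have hfib : ∀ x' : X', (ρ' ≫ g) x' = genericPoint W → x' = genericPoint X' := by
    intro x' hx'
    rw [Scheme.Hom.comp_apply] at hx'
    have h1 : ρ' x' = genericPoint X := TowerTransport.eq_genericPoint_of_isIntegralHom g hx'
    obtain ⟨U, hU, -, hUiso⟩ := hρ'.isBirational
    haveI := hUiso
    have hηU : genericPoint X ∈ U :=
      ((genericPoint_spec X).mem_open_set_iff U.isOpen).mpr (by simpa using hU.nonempty)
    exact TowerTransport.subsingleton_preimage_of_isIso_morphismRestrict ρ' U hηU h1
      (RatFn.genericPoint_eq_of_isDominant ρ')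
  exact TowerTransport.hasResolution_normalizationIn_of_isProper hK0 W f L X' (ρ' ≫ g) hcompat
    hfib hres'

/-- **`FunctionFieldOver` form**: for `g : X → W` finite dominant between integral schemes, `W`
locally of finite type over a field, a resolution of `X` gives a resolution of the normalization
`W^{K(X)}` of `W` in `K(X)`. [folklore] -/
theorem hasResolution_normalizationIn_functionFieldOver {k : Type} [Field k] (X W : Scheme.{0})
    [IsIntegral X] [IsIntegral W] (f : W ⟶ Spec (.of k)) [LocallyOfFiniteType f] (g : X ⟶ W)
    [IsFinite g] [IsDominant g] (hres : Scheme.HasResolution X) :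
    Scheme.HasResolution (normalizationIn W (FunctionFieldOver g)) :=
  hasResolution_normalizationIn_of_hasResolution W f (FunctionFieldOver g) X g
    (FunctionFieldOver.of g).toRingHom (RingHom.ext fun h => (FunctionFieldOver.algebraMap_apply g h).symm)
    (FunctionFieldOver.of g).surjective hres

/-- **A finite cover of a variety is resolvable iff the normalization of the base in its function
field is**: for `g : X → W` finite dominant between integral schemes, `W` locally of finite type
over a field `k`, `X` has a resolution iff `W^{K(X)}` has one (⟸ is the landed
`OfNormalizationIn.stub_ofNormalizationIn`: the comparison `W^{K(X)} → X` is finite birational).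
[folklore] -/
theorem hasResolution_iff_hasResolution_normalizationIn : ∀ (k : Type) [Field k] (X W : Scheme.{0}) [IsIntegral X] [IsIntegral W] (f : W ⟶ Spec (.of k)) [LocallyOfFiniteType f] (g : X ⟶ W) [IsFinite g] [IsDominant g], Scheme.HasResolution X ↔ Scheme.HasResolution (normalizationIn W (FunctionFieldOver g)) :=
  fun k _ X W _ _ f _ g _ _ =>
    ⟨hasResolution_normalizationIn_functionFieldOver X W f g,
      OfNormalizationIn.stub_ofNormalizationIn k X W f g
        (FunctionFieldNormalizationIn.stub_functionField_normalizationIn W (FunctionFieldOver g))⟩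

end Summit.ResolutionOfSingularities.ResolutionOfSingularities.Theorems.Picover.LiftToNormalizationIn

end
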